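import Summits.QuantumFields.YangMills.Theorems.BalabanUVNodesN16HolderMSAtTupleReading13Generic
import Summits.QuantumFields.YangMills.Theorems.BalabanUVNodesRateReadingOfRecord13Co

/-!
# Route «BalabanUVNodes», cluster K4 «SpineRates» — node N16 = NE3: THE R-β″ CONJUNCT AT THE LEVEL-SELECTED TUPLE READING OF dag-n22-e's Co READING OF RECORD
# `rateCarriersOfRecord₁₃Co (readingOfRecord₁₃Co w1 ℓ₃ ne2 ne1) · · · · · (ksel …)` (Co edition, `Provisos₁₃Core`-keyed, Co datum) — the MS β-conjunct
# «`∀ F θ hc, (Rg F θ →) θ.Admissible F N → ∀ g₀ os, N16HolderMSAt (…).ne3 β`» is ONE `N16HolderMSAt` per family (`hpin := rfl` in the proviso-GENERIC module 29ᴳ), and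
# ★ THE MS N16 LINE at that reading

CORE EDITION (plan g67 CORE-YES, 2026-08-27): node00-def-T's `Node00/Record13.lean` v1.2 (p501191) carries the bg-FREE core proviso `Stage13Params.Provisos₁₃Core` — the rows
every located revision of the background-field row `bg` (v1.2 `Provisos₁₃Sep`, v1.3 `Provisos₁₃SepMixed` p511029, …) shares, each with a one-way `….toCore` — with
`datumOfRecord₁₃Core` (`datumOfRecord₁₃Sep_eq_core` ∕ `datumOfRecord₁₃SepMixed_eq_core`, `rfl`); RR-2's key twin `Node00/Record13DatumKeyCore` and dag-n22-e's (T-RATE) layer-B ∕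
reading-of-record Core twins (`RateReading₁₃Co`, `rateCarriersOfRecord₁₃Co`, `RRec₁₃Co(On)`, `readingOfRecord₁₃Co`, face `readingOfRecord₁₃Co_ne3OfRecord`, …) followed.
The plan ruled (CORE-YES (i)–(iii), INBOX l.17420) that bg-blind CONSUMER storeys key ONCE on the core proviso — applied at any item edition's tuple `(θ, h : θ.Provisos₁₃… F N)` by
`hc := h.toCore`, datum by `rfl` — while the ITEM texts K0–K3 stay keyed on the guarded proviso of record (`SepMixed`, rev 20): THIS is the LAST record re-key of this module.
THIS FILE is module 29Sep `…N16HolderMSAtTupleReading13Sep` (p507163) §2 under `Sep ↦ Core`; its `hpin`-generic §1 is NOT re-typed at the core proviso but CITED from this seat's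
proviso-GENERIC module 29ᴳ `…N16HolderMSAtTupleReading13Generic` (generation 7; `P := fun F θ => θ.Provisos₁₃Core F N` by unification).

Cell `pub-ymgap`, seat `pub-ymgap-dag-n16-e` (R134 acceleration seat (a), strategy s2 = BY-NAME KNIT at the record; HUMAN RULING D-0062; chair R424 venue), generation 7,
module 29ᶜ (THEOREMS ONLY, 0 `def`, 0 `sorry`).  `--kind proof --supports <K3 id of record> --as helper` (dag-lead KEY MAP).  `bears_on: R4∕N16 · edge N05 → N16 · out-edge N16 → N21`.
Over module 29ᴳ (`n16HolderMS_tupleReading(On)_iff_ofRecord`, ★ `n16HolderMS_tupleReadingOn_ofRecord_of_window_linear` — through it this seat's (F2-MS) `…N16HolderMSSlotWindow`,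
(E2-MS) `…N16HolderMSLeafSlot`, (E1-MS) `…N16HolderMSRegime`, dag-n16-c's `…N16HolderMSDefs`) and dag-n22-e's 6″ᶜ `…RateReadingOfRecord13Co` (`readingOfRecord₁₃Co`,
`rateCarriersOfRecord₁₃Co`).

CONTENT.
§2 AT THE LEVEL-SELECTED TUPLE READING OF dag-n22-e's Co READING OF RECORD (`w1`∕`ne2`∕`ne1`∕`ksel` generic, every `hpin := rfl`) — `n16HolderMS_tupleReadingOfRecordCo_iff`,
  `n16HolderMS_tupleReadingOfRecordCoOn_iff`, ★ `n16HolderMS_tupleReadingOfRecordCoOn_of_window_linear` (THE MS N16 LINE: N05's `Thm4Body` ∕ `Prop3Body` on the univ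
  sub-family of `zdGF3 (M_N ℂ) F.L β (len F)` with the MS length letter + N07's `LeafH3sup`, once per GUARDED family carrying an admissible tuple with the core proviso).

HONEST FRAMING.  Kernel bookkeeping by name; no estimate; N05's `Thm4Body` ∕ `Prop3Body` and N07's `LeafH3sup` are HYPOTHESES asserted for no family; `N16HolderMSAt · β` is
dag-n16-c's CANDIDATE wording for R-β″ (UNRULED; nothing of record edited); `w1` ∕ `ne2` ∕ `ne1` ∕ `ksel` are PARAMETERS ∕ residual DATA; no admissible Stage-13 tuple with the core
proviso (a fortiori with any guarded proviso of record) is claimed to exist (K0 OPEN at every edition); nothing of Bałaban's asserted; **N16 ∕ NE3 is NOT discharged**;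
count-neutral (typed 28∕28 · discharged 5∕27, A 5∕28 UNMOVED); one finite four-torus at fixed ε — NOT ℝ⁴, NOT infinite volume, NOT OS, NOT a mass gap, NOT Clay.  No decl below
carries a cite tag (all `[folklore]` bookkeeping).
-/

set_option autoImplicit false

open scoped BigOperators Matrix Matrix.Norms.L2Operator
open NormedSpace

namespace Summit.QuantumFields.YangMills.BalabanUVNodes.N16HolderMSAtTupleReading13Co

open Literature.MathematicalPhysics.QuantumFieldTheory.Balaban1983to89
open Literature.MathematicalPhysics.QuantumFieldTheory.Balaban1983to89.T4Continuum (T4Family ULoop)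
open B7Prop1Explicit B7Prop2Explicit
open B7Prop3Flat (c3)
open B8LeafModelZd (ZdIdx)
open B8LeafModelZd3 (zdGF3)
open Node00 (Stage13Params NE3Objects₁₁ NE3Letters₁₁ NE2Objects₁₁ ne3LOfRecord₁₁ ne3ConstLayerOfRecord₁₁ ne3NperOfRecord₁₁ ne3DomOfRecord₁₁ two_le_ne3LOfRecord₁₁ MatA)
open Node00.W1 (ReadingData)
open Summit.QuantumFields.BalabanUV.T4Continuum
open MinimalActionRate (sfClass)
open BlockAverageCurrent (curConst)
open NE3RightInverseSupLetters (frameC)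
open NE3.LeafIndexSockets (LeafH3sup)
open YMDAG.UVSplit (NE3Carriers NE1pCarriers RateCarriers ne3OfRecord₁₁ rateCarriersOfRecord₁₃Co readingOfRecord₁₃Co)
open Summit.QuantumFields.YangMills.BalabanUVNodes.N16HolderMSDefs (N16HolderMSAt)
open Summit.QuantumFields.YangMills.BalabanUVNodes.N16HolderMSRegime (radiusOfRecordHMS constOfRecordHMS)
open Summit.QuantumFields.YangMills.BalabanUVNodes.N16HolderMSAtTupleReading13Generic (n16HolderMS_tupleReading_iff_ofRecord n16HolderMS_tupleReadingOn_iff_ofRecord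
  n16HolderMS_tupleReadingOn_ofRecord_of_window_linear)

noncomputable section

variable {N : ℕ} [NeZero N] (Rg : (F : T4Family) → Stage13Params F N → Prop) (ℓ : T4Family → NE3Letters₁₁) (β : ℝ)

/-! ## §2 At the LEVEL-SELECTED tuple reading of dag-n22-e's Co reading of record (`hpin := rfl`; §1 = module 29ᴳ, cited) -/

section NamedReading

variable (w1 : (F : T4Family) → (θ : Stage13Params F N) → ReadingData F (MatA N) θ.τ9.M)
  (ne2 : (F : T4Family) → Stage13Params F N → (ℕ → ℝ) → List (ULoop F) → ℕ → NE2Objects₁₁)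
  (ne1 : (F : T4Family) → Stage13Params F N → (ℕ → ℝ) → List (ULoop F) → NE1pCarriers)
  (ksel : (F : T4Family) → Stage13Params F N → (ℕ → ℝ) → List (ULoop F) → ℕ)

/-- **THE MS β-CONJUNCT AT THE LEVEL-SELECTED TUPLE READING OF RECORD IS ONE `N16HolderMSAt … β` PER FAMILY CARRYING AN ADMISSIBLE TUPLE**
(`rr F θ hP g₀ os := rateCarriersOfRecord₁₃Co (readingOfRecord₁₃Co w1 ℓ ne2 ne1) F θ hP g₀ os (ksel F θ g₀ os)`; the component by `rfl`). [folklore] -/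
theorem n16HolderMS_tupleReadingOfRecordCo_iff :
    (∀ (F : T4Family) (θ : Stage13Params F N) (hP : θ.Provisos₁₃Core F N), θ.Admissible F N → ∀ (g₀ : ℕ → ℝ) (os : List (ULoop F)),
        N16HolderMSAt (rateCarriersOfRecord₁₃Co (readingOfRecord₁₃Co w1 ℓ ne2 ne1) F θ hP g₀ os (ksel F θ g₀ os)).ne3 β) ↔
      ∀ (F : T4Family), (∃ θ : Stage13Params F N, θ.Provisos₁₃Core F N ∧ θ.Admissible F N) →
        N16HolderMSAt (ne3OfRecord₁₁ F (ne3ConstLayerOfRecord₁₁ F N (ℓ F))) β :=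
  n16HolderMS_tupleReading_iff_ofRecord (fun F θ hP g₀ os => rateCarriersOfRecord₁₃Co (readingOfRecord₁₃Co w1 ℓ ne2 ne1) F θ hP g₀ os (ksel F θ g₀ os)) ℓ β
    fun _ _ _ _ _ => rfl

/-- **… AND GUARDED** (regime `Rg F θ` inside the binder). [folklore] -/
theorem n16HolderMS_tupleReadingOfRecordCoOn_iff :
    (∀ (F : T4Family) (θ : Stage13Params F N) (hP : θ.Provisos₁₃Core F N), Rg F θ → θ.Admissible F N → ∀ (g₀ : ℕ → ℝ) (os : List (ULoop F)),
        N16HolderMSAt (rateCarriersOfRecord₁₃Co (readingOfRecord₁₃Co w1 ℓ ne2 ne1) F θ hP g₀ os (ksel F θ g₀ os)).ne3 β) ↔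
      ∀ (F : T4Family), (∃ θ : Stage13Params F N, θ.Provisos₁₃Core F N ∧ Rg F θ ∧ θ.Admissible F N) →
        N16HolderMSAt (ne3OfRecord₁₁ F (ne3ConstLayerOfRecord₁₁ F N (ℓ F))) β :=
  n16HolderMS_tupleReadingOn_iff_ofRecord (fun F θ hP g₀ os => rateCarriersOfRecord₁₃Co (readingOfRecord₁₃Co w1 ℓ ne2 ne1) F θ hP g₀ os (ksel F θ g₀ os)) Rg ℓ β
    fun _ _ _ _ _ => rfl

variable {β} (hβ0 : 0 ≤ β) (hβ1 : β ≤ 1)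
  {len : T4Family → Site 4 → ℝ} {c₁ c₁' B₁' cP C₂ B₀β : T4Family → ℝ} {inp : T4Family → B8.B9Inputs} {α b' c' : T4Family → ℝ}
  (hlen : ∀ (F : T4Family) (v : Site 4), 0 < len F v → 1 ≤ len F v) (hlenj : ∀ (F : T4Family) (μ : Fin 4) (j : ℕ), len F (j • e μ) = j)
  (hB₁' : ∀ F, 0 < B₁' F) (hBB : ∀ F : T4Family, 5 * ((4 : ℕ) : ℝ) * F.L * (inp F).B₀ ≤ B₁' F) (hc₁' : ∀ F, 0 < c₁' F)
  (hwin : ∀ (F : T4Family) (α₀ α₁ : ℝ), 0 < α₀ → 0 < α₁ → α₀ + α₁ ≤ c₁' F →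
    α₀ + α₁ ≤ c₁ F ∧ C0 4 * (2 * α₀) ≤ 1 / 3 ∧ 4 * α₀ ≤ c2' 4 F.L ∧ 16 * (B₁' F * (α₀ + α₁)) ≤ 1 ∧
    Real.exp (4 * (800 * (((4 : ℕ) : ℝ) + 1) ^ 2 * (((4 : ℕ) : ℝ) + 4)) * α₀) * (1 + 8 * (131072 * (((4 : ℕ) : ℝ) + 1) ^ 2) * (B₁' F * (α₀ + α₁))) ≤ 2 ∧
    2 * (B₁' F * (α₀ + α₁)) ≤ c3 4 F.L ∧ ((4 : ℕ) : ℝ) * F.L * α₁ ≤ 1 / 8 ∧ α₀ ≤ cP F ∧ α₁ ≤ cP F ∧ B₁' F * (α₀ + α₁) ≤ cP F ∧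
    2 * (B₁' F * (α₀ + α₁)) ^ 2 + 20 * ((4 : ℕ) : ℝ) * α₀ * (B₁' F * (α₀ + α₁)) + 2 * C₂ F * (B₁' F * (α₀ + α₁)) ^ 2 ≤ α₀ + α₁)
  (hα : ∀ F, 0 < α F) (hα1 : ∀ F, α F ≤ c₁' F / 177)
  (hα2 : ∀ F : T4Family, α F ≤ (ℓ F).Λ₁ / (1770 * (5 * ((4 : ℕ) : ℝ) * F.L * (inp F).B₀) + 1))
  (hα3 : ∀ F : T4Family, α F ≤ c2' 4 F.L / 2)
  (hα4 : ∀ F : T4Family, α F ≤ 1 / ((23040 * (4 : ℝ) ^ 4 * (frameC 4 F.L + 4) ^ 3 + 12) * (1 + curConst 4 F.L) + 1))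
  (hα5 : ∀ F, α F ≤ 1 / 10 ^ 9)
  (hg : ∀ F, 0 < (ℓ F).g) (hε0 : ∀ F, 0 < (ℓ F).ε) (hε : ∀ F, (ℓ F).ε < α F)
  (hΛ₁r : ∀ F : T4Family, (ℓ F).Λ₁ ≤ radiusOfRecordHMS N F.L (ne3NperOfRecord₁₁ F 0 0))
  (hb : ∀ F, 0 ≤ (ℓ F).b ∧ (ℓ F).b ≤ (ℓ F).ε / 2) (hC : ∀ F : T4Family, constOfRecordHMS N F.L (ne3NperOfRecord₁₁ F 0 0) (ℓ F).g ≤ (ℓ F).C)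
  (hΛ₂' : ∀ F : T4Family, 177 * α F * (5 * ((4 : ℕ) : ℝ) * F.L * B₀β F + 5 * ((4 : ℕ) : ℝ) * F.L * (inp F).B₀) ≤ (ℓ F).Λ₂')
  (hb' : ∀ F, 0 ≤ b' F ∧ b' F ≤ α F / 2048) (hc' : ∀ F, 0 ≤ c' F ∧ c' F ≤ α F / 24)
include hβ0 hβ1 hlen hlenj hB₁' hBB hc₁' hwin hα hα1 hα2 hα3 hα4 hα5 hg hε0 hε hΛ₁r hb hC hΛ₂' hb' hc'

/-- ★ **THE MS N16 LINE AT THE LEVEL-SELECTED TUPLE READING OF RECORD, GUARDED** — the content once per guarded family gives the guarded `KeyedRates` binder at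
`rr := rateCarriersOfRecord₁₃Co (readingOfRecord₁₃Co w1 ℓ ne2 ne1) · · · · · (ksel …)` (§1 at `rfl`; the composer conjoins it with the other five nodes' conjuncts at the same `rr`).
[folklore] -/
theorem n16HolderMS_tupleReadingOfRecordCoOn_of_window_linear
    (hcontent : ∀ (F : T4Family), (∃ θ : Stage13Params F N, θ.Provisos₁₃Core F N ∧ Rg F θ ∧ θ.Admissible F N) →
      letI : CStarAlgebra (Matrix (Fin N) (Fin N) ℂ) := {}
      B8.Thm4Body (c₁ F) (B₁' F) (fun i : {i : ZdIdx 4 F.L // i.Ω 0 = Set.univ} => (zdGF3 (Matrix (Fin N) (Fin N) ℂ) F.L β (len F) i.1).toGFData) ∧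
        B8.Prop3Body (cP F) 4 (F.L : ℝ) (C₂ F) (inp F) (B₀β F)
          (fun i : {i : ZdIdx 4 F.L // i.Ω 0 = Set.univ} => (zdGF3 (Matrix (Fin N) (Fin N) ℂ) F.L β (len F) i.1).toGFData2) ∧
        LeafH3sup 4 F.L (ne3NperOfRecord₁₁ F 0 0) (ℓ F).ε (b' F) (c' F) (ne3DomOfRecord₁₁ F N 0 0)) :
    ∀ (F : T4Family) (θ : Stage13Params F N) (hP : θ.Provisos₁₃Core F N), Rg F θ → θ.Admissible F N → ∀ (g₀ : ℕ → ℝ) (os : List (ULoop F)),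
      N16HolderMSAt (rateCarriersOfRecord₁₃Co (readingOfRecord₁₃Co w1 ℓ ne2 ne1) F θ hP g₀ os (ksel F θ g₀ os)).ne3 β :=
  n16HolderMS_tupleReadingOn_ofRecord_of_window_linear (fun F θ hP g₀ os => rateCarriersOfRecord₁₃Co (readingOfRecord₁₃Co w1 ℓ ne2 ne1) F θ hP g₀ os (ksel F θ g₀ os))
    Rg ℓ β (fun _ _ _ _ _ => rfl) hβ0 hβ1 hlen hlenj hB₁' hBB hc₁' hwin hα hα1 hα2 hα3 hα4 hα5 hg hε0 hε hΛ₁r hb hC hΛ₂' hb' hc' hcontent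

end NamedReading

end

end Summit.QuantumFields.YangMills.BalabanUVNodes.N16HolderMSAtTupleReading13Co
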